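import Literature.Topology.PlanarFoliations.VertSides
import HarnessLib

/-!
# The two sides of a compact leaf: points of a flow box

Sibling of `VertSides.lean`. In a flow box `e` at a point `k` of a compact leaf `K` (height `s`),
a point `p` of the box at height `t ≠ s` lies in the same complementary domain of `ι(K)` as the
point of the vertical through `k` at height `t` (the plaque at height `t` is connected and off
`K`), so **two points of the box at heights on opposite sides of `s` lie in different
complementary domains** (`mem_insideLeaf_iff_mem_outsideLeaf_of_lt`).

* `symm_not_mem_leaf_of_ne`, `mem_insideLeaf_iff_vert`, `mem_outsideLeaf_iff_vert`,
  `mem_insideLeaf_iff_mem_outsideLeaf_of_lt` (**proved**).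

All statements are [folklore].
-/

noncomputable section

open Set Filter Function Bornology
open _root_.Topology
open Literature.Topology.FourManifolds Literature.Topology.FourManifolds.Foliation

namespace Literature.Topology.PlanarFoliations

variable {X : Type*} [TopologicalSpace X] [T2Space X] [SecondCountableTopology X] {F : Foliation ℝ X}
variable {e : OpenPartialHomeomorph X (ℝ × ℝ)} {ι : X → ℂ}

/-- In a box at `k ∈ K`, the points at heights other than that of `k` are off the compact leaf
`K`. [folklore] -/
theorem symm_not_mem_leaf_of_ne (hbi : IsBiOriented F) (hι : IsOpenEmbedding ι) {y : X} (hK : IsCompact (F.leaf y)) (he : e ∈ F.atlas)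
    {k : X} (hk : k ∈ F.leaf y) (hke : k ∈ e.source) {u t : ℝ} (ht : t ≠ (e k).2) : e.symm (u, t) ∉ F.leaf y := fun h ↦
  vert_not_mem_leaf hbi hι hK he hk hke ht
    (F.plaque_subset_leaf_of_mem he h (F.symm_mem_plaque he u t) (F.symm_mem_plaque he (e k).1 t))

/-- **A point of the box is inner iff the vertical point at its height is inner** (heights other
than that of `k`). [folklore] -/
theorem mem_insideLeaf_iff_vert (hbi : IsBiOriented F) (hι : IsOpenEmbedding ι) {y : X} (hK : IsCompact (F.leaf y)) (he : e ∈ F.atlas)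
    {k : X} (hk : k ∈ F.leaf y) (hke : k ∈ e.source) {p : X} (hp : p ∈ e.source) (ht : (e p).2 ≠ (e k).2) :
    ι p ∈ insideLeaf F ι y ↔ ι (e.symm ((e k).1, (e p).2)) ∈ insideLeaf F ι y := by
  haveI : Nontrivial X := nontrivial_of_foliation F y
  -- the row at the height of `p`
  set S : Set ℂ := (fun u : ℝ ↦ ι (e.symm (u, (e p).2))) '' univ with hS
  have hSc : IsPreconnected S :=
    isPreconnected_univ.image _ ((isOpenEmbedding_symm he hι).continuous.comp (continuous_id.prodMk continuous_const)).continuousOn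
  have hSK : Disjoint S (ι '' F.leaf y) := disjoint_left.2 (by
    rintro _ ⟨u, -, rfl⟩ h
    exact symm_not_mem_leaf_of_ne hbi hι hK he hk hke ht ((hι.injective.mem_set_image).1 h))
  have hpS : ι p ∈ S := ⟨(e p).1, mem_univ _, by show ι (e.symm ((e p).1, (e p).2)) = ι p; rw [show ((e p).1, (e p).2) = e p from rfl, e.left_inv hp]⟩
  have hvS : ι (e.symm ((e k).1, (e p).2)) ∈ S := ⟨(e k).1, mem_univ _, rfl⟩
  constructor
  · intro h; exact subset_insideLeaf_of_isPreconnected hbi hι hK hSc hSK ⟨_, hpS, h⟩ hvS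
  · intro h; exact subset_insideLeaf_of_isPreconnected hbi hι hK hSc hSK ⟨_, hvS, h⟩ hpS

/-- The same for the outer domain. [folklore] -/
theorem mem_outsideLeaf_iff_vert (hbi : IsBiOriented F) (hι : IsOpenEmbedding ι) {y : X} (hK : IsCompact (F.leaf y)) (he : e ∈ F.atlas)
    {k : X} (hk : k ∈ F.leaf y) (hke : k ∈ e.source) {p : X} (hp : p ∈ e.source) (ht : (e p).2 ≠ (e k).2) :
    ι p ∈ outsideLeaf F ι y ↔ ι (e.symm ((e k).1, (e p).2)) ∈ outsideLeaf F ι y := by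
  haveI : Nontrivial X := nontrivial_of_foliation F y
  set S : Set ℂ := (fun u : ℝ ↦ ι (e.symm (u, (e p).2))) '' univ with hS
  have hSc : IsPreconnected S :=
    isPreconnected_univ.image _ ((isOpenEmbedding_symm he hι).continuous.comp (continuous_id.prodMk continuous_const)).continuousOn
  have hSK : Disjoint S (ι '' F.leaf y) := disjoint_left.2 (by
    rintro _ ⟨u, -, rfl⟩ h
    exact symm_not_mem_leaf_of_ne hbi hι hK he hk hke ht ((hι.injective.mem_set_image).1 h))
  have hpS : ι p ∈ S := ⟨(e p).1, mem_univ _, by show ι (e.symm ((e p).1, (e p).2)) = ι p; rw [show ((e p).1, (e p).2) = e p from rfl, e.left_inv hp]⟩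
  have hvS : ι (e.symm ((e k).1, (e p).2)) ∈ S := ⟨(e k).1, mem_univ _, rfl⟩
  constructor
  · intro h; exact subset_outsideLeaf_of_isPreconnected hbi hι hK hSc hSK ⟨_, hpS, h⟩ hvS
  · intro h; exact subset_outsideLeaf_of_isPreconnected hbi hι hK hSc hSK ⟨_, hvS, h⟩ hpS

/-- **Two points of a box at a point of a compact leaf, at heights on opposite sides of it, lie
in different complementary domains.** [folklore] -/
theorem mem_insideLeaf_iff_mem_outsideLeaf_of_lt (hbi : IsBiOriented F) (hι : IsOpenEmbedding ι) {y : X} (hK : IsCompact (F.leaf y))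
    (he : e ∈ F.atlas) {k : X} (hk : k ∈ F.leaf y) (hke : k ∈ e.source) {p q : X} (hp : p ∈ e.source) (hq : q ∈ e.source)
    (hpk : (e p).2 < (e k).2) (hkq : (e k).2 < (e q).2) : ι p ∈ insideLeaf F ι y ↔ ι q ∈ outsideLeaf F ι y := by
  rw [mem_insideLeaf_iff_vert hbi hι hK he hk hke hp hpk.ne, mem_outsideLeaf_iff_vert hbi hι hK he hk hke hq hkq.ne']
  exact mem_insideLeaf_iff_mem_outsideLeaf hbi hι hK he hk hke hpk hkq

end Literature.Topology.PlanarFoliations
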